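import Literature.NumberTheory.GaloisRepresentations.PowerSeriesTopNilpotentModule
import Mathlib.RingTheory.PowerSeries.Derivative
import Literature.NumberTheory.GaloisRepresentations.ProfiniteContinuousSection
import HarnessLib

/-!
# The `S⟦T⟧`-action `c(T)·r = Σ c_k D^k r` is CONTINUOUS (coefficientwise topology), `TActModule D hD` is a compact topological
# `S⟦T⟧`-module, and CLOSED subgroups stable under `D` and the constants are `S⟦T⟧`-SUBMODULES (Iwasawa's "`Λ`-modules are the
# compact `ℤ_p⟦Γ⟧`-modules", de Shalit I §3.1 / Washington §13.2) — the topological half of `PowerSeriesTopNilpotentAction/Module`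

De Shalit, *Iwasawa theory of elliptic curves with complex multiplication* (1987), Ch. I §3.1 ("`Λ = ℤ_p⟦Γ⟧ ≅ ℤ_p⟦S⟧` … continuous
`ℤ_p⟦𝒢⟧`-modules"), §3.4 Corollary ("`i` is an injective homomorphism of `ℤ_p⟦𝒢⟧`-modules" — `ℤ_p⟦𝒢⟧`-linearity of a map given on group
elements REQUIRES continuity), §3.7 ("`i` extended by linearity to the completed tensor product"); Washington, *Introduction to Cyclotomic
Fields* (1997) §13.2 ("a compact `ℤ_p⟦Γ⟧`-module becomes a `Λ`-module via `f(T)x = lim Σ c_k(γ−1)^k x` … closed `Γ`-submodules are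
`Λ`-submodules").  The files `PowerSeriesTopNilpotentAction` / `PowerSeriesTopNilpotentModule` built the action `tAct D hD c r` of `S⟦T⟧` on
`S⟦Y⟧` through a topologically nilpotent `S`-linear `D` (`D(I_N) ⊆ I_{N+1}`, `I_N = adicFiltGen p N`) PURELY ALGEBRAICALLY (as `(p, Y)`-adic
limits characterised by congruences).  THIS file adds the topology (everything for the COEFFICIENTWISE = product topology
`PowerSeries.WithPiTopology` over a topological ring `S` in which `p^n S → 0` uniformly):

* §1 generic: `continuous_of_isClosed_graph'` (a map into a COMPACT space with closed graph is continuous — the tree's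
  `continuous_of_isClosed_graph` of `ProfiniteContinuousSection` in predicate form; the tool by which the Coleman maps, defined by
  `∃!`-characterisations, are shown continuous in the sequel files), `PowerSeries.WithPiTopology.compactSpace`,
  `continuous_iff_coeff`, `continuous_map_of_continuous`, `continuous_derivative`, ★ `continuous_subst_of_constantCoeff_eq_zero`
  (substitution of a FIXED constant-term-free series is continuous over any topological ring — Mathlib's `continuous_subst` wants discrete
  coefficients), `denseRange` helpers;
* §2 ★ `tendsto_tPartial_tAct` (the partial sums CONVERGE to `c(T)·r` in the topology), ★★ `continuous_tAct` (JOINT continuity in `(c, r)`,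
  uniform approximation by the polynomial operators `tPartial`);
* §3 `TActModule D hD` as a topological module: topology = that of `S⟦Y⟧`, `IsTopologicalAddGroup`, `T2Space`, ★ `CompactSpace` (for compact
  `S`), ★★ `ContinuousSMul (PowerSeries S) (TActModule D hD)`;
* §4 ★★★ `smul_mem_of_isClosed` — in ANY topological `S⟦T⟧`-module with `c ↦ c • z` continuous, a CLOSED additive subgroup stable under `T•`
  and the constants `C s •` is stable under every `c ∈ S⟦T⟧` (polynomials are dense: Mathlib `denseRange_toPowerSeries`); the submodule
  `submoduleOfIsClosed`; ★ `C_smul_mem_of_dense` (constants from a dense subset suffice, e.g. `ℕ ⊆ ℤ_p`), ★ `C_smul_mem_of_C_C_of_C_X`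
  (two variables `S = S₀⟦X⟧`: constants `C (C a)` and `C X` suffice) — so a closed subgroup stable under the GROUP-LIKE operators
  `1 + T ↦ σ_γ`, `1 + X ↦ φ` and `ℕ` is an `S₀⟦X⟧⟦T⟧`-submodule whenever `ℕ` is dense in `S₀` (`S₀ = ℤ_p`).

Everything PROVED (0 sorry, no named fact); instances only on the tree's own synonym `TActModule` (topology transported from `S⟦Y⟧`).

## References
* E. de Shalit, *Iwasawa theory of elliptic curves with complex multiplication* (1987), Ch. I §3.1, §3.4 Corollary, §3.7. [deShalit1987]
* L. C. Washington, *Introduction to Cyclotomic Fields*, 2nd ed. (1997), §7.1, §13.2 (compact `Λ`-modules). [Washington1997]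
-/

noncomputable section

open Filter Topology Finset
open scoped PowerSeries.WithPiTopology

namespace Literature.NumberTheory.GaloisRepresentations

/-! ### §1. Generic facts on the coefficientwise topology -/

section Generic

/-- A map with closed graph into a compact space, in the two-variable form `{(x, y) | P x y}`. [cite: BourbakiGT1, Ch. I §10.2 Cor. 5] -/
theorem continuous_of_isClosed_graph' {X Y : Type*} [TopologicalSpace X] [TopologicalSpace Y] [CompactSpace Y]
    {f : X → Y} {P : X → Y → Prop} (hP : ∀ x y, P x y ↔ f x = y) (h : IsClosed {q : X × Y | P q.1 q.2}) : Continuous f := by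
  refine continuous_of_isClosed_graph ?_
  have e : {q : X × Y | f q.1 = q.2} = {q : X × Y | P q.1 q.2} := Set.ext fun q => (hP q.1 q.2).symm
  rwa [e]

variable (R : Type*) [TopologicalSpace R]

/-- Power series over a COMPACT coefficient space are compact (coefficientwise topology = product topology; Tychonoff). [cite: BourbakiGT1, Ch. I §9.5 Th. 3] -/
theorem PowerSeries.WithPiTopology.compactSpace [CompactSpace R] : CompactSpace (PowerSeries R) :=
  show CompactSpace ((Unit →₀ ℕ) → R) from inferInstance

variable {R}

/-- A map into power series is continuous iff all its coefficients are (universal property of the product topology). [cite: BourbakiGT1, Ch. I §4.1 Prop. 1] -/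
theorem PowerSeries.WithPiTopology.continuous_iff_coeff [Semiring R] {X : Type*} [TopologicalSpace X] {f : X → PowerSeries R} :
    Continuous f ↔ ∀ n, Continuous fun x => PowerSeries.coeff n (f x) := by
  constructor
  · intro hf n
    exact (PowerSeries.WithPiTopology.continuous_coeff R n).comp hf
  · intro h
    refine continuous_pi_iff.mpr fun d => ?_
    have e : (fun x => f x d) = fun x => PowerSeries.coeff (d ()) (f x) := by
      funext x
      change MvPowerSeries.coeff d (f x) = MvPowerSeries.coeff (Finsupp.single () (d ())) (f x)
      rw [show Finsupp.single () (d ()) = d from (Finsupp.unique_single d).symm]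
    rw [e]
    exact h _

/-- `PowerSeries.map φ` is continuous for a continuous `φ` (coefficientwise). [cite: BourbakiGT1, Ch. I §4.1 Prop. 1] -/
theorem PowerSeries.WithPiTopology.continuous_map {T : Type*} [Semiring R] [Semiring T] [TopologicalSpace T] (φ : R →+* T)
    (hφ : Continuous φ) : Continuous (PowerSeries.map φ : PowerSeries R → PowerSeries T) := by
  refine PowerSeries.WithPiTopology.continuous_iff_coeff.mpr fun n => ?_
  simp only [PowerSeries.coeff_map]
  exact hφ.comp (PowerSeries.WithPiTopology.continuous_coeff R n)

/-- The formal derivative is continuous (coefficientwise: `[Y^n] f' = (n+1)[Y^{n+1}] f`). [cite: BourbakiGT1, Ch. I §4.1 Prop. 1] [cite: Lang2002, Ch. IV §9] -/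
theorem PowerSeries.WithPiTopology.continuous_derivative [CommSemiring R] [ContinuousMul R] :
    Continuous (PowerSeries.derivative R : PowerSeries R → PowerSeries R) := by
  refine PowerSeries.WithPiTopology.continuous_iff_coeff.mpr fun n => ?_
  simp only [PowerSeries.coeff_derivative]
  exact (PowerSeries.WithPiTopology.continuous_coeff R (n + 1)).mul continuous_const

omit [TopologicalSpace R] in
/-- The coefficients of `f ∘ a` for a constant-term-free `a` are FINITE sums: `[Y^n](f ∘ a) = Σ_{d ≤ n} [Y^d]f · [Y^n]a^d`. [cite: Lang2002, Ch. IV §9 (composition of power series)] -/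
theorem PowerSeries.coeff_subst_eq_sum_of_constantCoeff_eq_zero [CommRing R] {a : PowerSeries R} (ha : PowerSeries.constantCoeff a = 0)
    (f : PowerSeries R) (n : ℕ) :
    PowerSeries.coeff n (PowerSeries.subst a f) = ∑ d ∈ range (n + 1), PowerSeries.coeff d f * PowerSeries.coeff n (a ^ d) := by
  rw [PowerSeries.coeff_subst' (PowerSeries.HasSubst.of_constantCoeff_zero' ha)]
  refine (finsum_eq_sum_of_support_subset _ ?_).trans (sum_congr rfl fun d _ => by rw [smul_eq_mul])
  intro d hd
  rw [Function.mem_support] at hd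
  rw [coe_range, Set.mem_Iio]
  by_contra hnd
  rw [not_lt] at hnd
  have h0 : PowerSeries.coeff n (a ^ d) = 0 := by
    refine PowerSeries.coeff_of_lt_order n (lt_of_lt_of_le ?_ (PowerSeries.le_order_pow_of_constantCoeff_eq_zero d ha))
    exact_mod_cast (show n < d by omega)
  exact hd (by rw [h0, smul_zero])

/-- ★ **Substitution of a fixed constant-term-free series is continuous** in the coefficientwise topology over any topological ring
(each coefficient of `f ∘ a` is a polynomial in finitely many coefficients of `f`). [cite: Lang2002, Ch. IV §9] [cite: BourbakiGT1, Ch. I §4.1 Prop. 1] -/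
theorem PowerSeries.WithPiTopology.continuous_subst_of_constantCoeff_eq_zero [CommRing R] [IsTopologicalRing R] {a : PowerSeries R}
    (ha : PowerSeries.constantCoeff a = 0) : Continuous (PowerSeries.subst a : PowerSeries R → PowerSeries R) := by
  refine PowerSeries.WithPiTopology.continuous_iff_coeff.mpr fun n => ?_
  simp only [PowerSeries.coeff_subst_eq_sum_of_constantCoeff_eq_zero ha]
  exact continuous_finsetSum _ fun d _ => (PowerSeries.WithPiTopology.continuous_coeff R d).mul continuous_const

/-- Multiplication by a fixed series is continuous (topological ring of power series). [cite: BourbakiGT1, Ch. III §6.3] -/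
theorem PowerSeries.WithPiTopology.continuous_mul_left [CommRing R] [IsTopologicalRing R] (a : PowerSeries R) :
    Continuous fun f : PowerSeries R => a * f :=
  continuous_const.mul continuous_id

/-- **`p^n S → 0` UNIFORMLY passes to power series**: if every neighbourhood of `0 ∈ S` contains `p^n S` for some `n`, then every
neighbourhood of `0 ∈ S⟦X⟧` contains `(C p)^n S⟦X⟧` for some `n` (a basic neighbourhood constrains finitely many coefficients). [cite: BourbakiGT1, Ch. I §4.1] -/
theorem PowerSeries.WithPiTopology.exists_pow_mul_mem_nhds [CommRing R] {p : R} (hp : ∀ U ∈ 𝓝 (0 : R), ∃ n : ℕ, ∀ s : R, p ^ n * s ∈ U)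
    (U : Set (PowerSeries R)) (hU : U ∈ 𝓝 (0 : PowerSeries R)) :
    ∃ n : ℕ, ∀ s : PowerSeries R, (PowerSeries.C p) ^ n * s ∈ U := by
  -- a basic neighbourhood: finitely many coefficients in neighbourhoods of `0`
  have hU' : U ∈ 𝓝 (fun _ : Unit →₀ ℕ => (0 : R)) := hU
  rw [nhds_pi] at hU'
  obtain ⟨I, hI, t, ht, hsub⟩ := Filter.mem_pi.mp hU'
  classical
  choose n hn using fun i => hp (t i) (ht i)
  refine ⟨hI.toFinset.sup n, fun s => hsub fun i hi => ?_⟩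
  change ((PowerSeries.C p) ^ (hI.toFinset.sup n) * s : PowerSeries R) i ∈ t i
  have e : ((PowerSeries.C p) ^ (hI.toFinset.sup n) * s : PowerSeries R) i = p ^ (hI.toFinset.sup n) * MvPowerSeries.coeff i s := by
    rw [← map_pow]
    change MvPowerSeries.coeff i (MvPowerSeries.C (p ^ hI.toFinset.sup n) * s) = _
    rw [MvPowerSeries.coeff_C_mul]
  rw [e]
  obtain ⟨k, hk⟩ := Nat.exists_eq_add_of_le (Finset.le_sup (f := n) (hI.mem_toFinset.mpr hi))
  rw [hk, pow_add, mul_assoc]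
  exact hn i _

end Generic

namespace LubinTate

/-! ### §2. Convergence of the partial sums and continuity of `c(T)·r` -/

section TActContinuous

variable {S : Type*} [CommRing S] {p : S} {D : PowerSeries S →ₗ[S] PowerSeries S}
  (hD : ∀ N (r : PowerSeries S), r ∈ adicFiltGen p N → D r ∈ adicFiltGen p (N + 1))
variable [TopologicalSpace S] [IsTopologicalRing S]

omit [TopologicalSpace S] [IsTopologicalRing S] in
/-- A member of `I_K` has `k`-th coefficient in `p^{K-k} S` (unfolding `adicFiltGen`). [cite: Washington1997, §7.1] -/
theorem exists_coeff_eq_pow_mul_of_mem_adicFiltGen {K k : ℕ} {V : PowerSeries S} (hV : V ∈ adicFiltGen p K) :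
    ∃ s : S, PowerSeries.coeff k V = p ^ (K - k) * s := by
  obtain ⟨s, hs⟩ := Ideal.mem_span_singleton'.mp (mem_adicFiltGen_iff.mp hV k)
  exact ⟨s, by rw [← hs, mul_comm]⟩

include hD in
/-- ★ **The partial sums converge to `c(T)·r`** in the coefficientwise topology, provided `p^n S → 0` uniformly
(`tAct c r ≡ tPartial c r K (mod I_K)` and `[Y^k] I_K = p^{K-k}S`). [cite: Washington1997, §13.2] -/
theorem tendsto_tPartial_tAct [IsPrecomplete (Ideal.span {p}) S] (hp : ∀ U ∈ 𝓝 (0 : S), ∃ n : ℕ, ∀ s : S, p ^ n * s ∈ U)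
    (c r : PowerSeries S) : Tendsto (fun K => tPartial D c r K) atTop (𝓝 (tAct D hD c r)) := by
  rw [PowerSeries.WithPiTopology.tendsto_iff_coeff_tendsto]
  intro k
  -- `coeff k (tPartial K) = coeff k (tAct) - p^{K-k} s_K → coeff k (tAct)`
  have key : ∀ K, ∃ s : S, PowerSeries.coeff k (tPartial D c r K) = PowerSeries.coeff k (tAct D hD c r) - p ^ (K - k) * s := by
    intro K
    obtain ⟨s, hs⟩ := exists_coeff_eq_pow_mul_of_mem_adicFiltGen (k := k) (tAct_sub_tPartial_mem hD c r K)
    refine ⟨s, ?_⟩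
    rw [map_sub] at hs
    rw [← hs, sub_sub_cancel]
  choose s hs using key
  have e : (fun K => PowerSeries.coeff k (tPartial D c r K)) = fun K => PowerSeries.coeff k (tAct D hD c r) - p ^ (K - k) * s K :=
    funext hs
  rw [e, show 𝓝 (PowerSeries.coeff k (tAct D hD c r)) = 𝓝 (PowerSeries.coeff k (tAct D hD c r) - 0) by rw [sub_zero]]
  refine tendsto_const_nhds.sub ?_
  -- `p^{K-k} s_K → 0`
  rw [tendsto_def]
  intro U hU
  obtain ⟨n, hn⟩ := hp U hU
  rw [mem_atTop_sets]
  refine ⟨n + k, fun K hK => ?_⟩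
  rw [Set.mem_preimage]
  obtain ⟨j, hj⟩ := Nat.exists_eq_add_of_le (show n ≤ K - k by omega)
  rw [hj, pow_add, mul_assoc]
  exact hn _

/-- The partial sum `(c, r) ↦ Σ_{k<K} c_k D^k r` is jointly continuous (for continuous `D`). [cite: Washington1997, §13.2] -/
theorem continuous_tPartial (hDc : Continuous D) (K : ℕ) :
    Continuous fun cr : PowerSeries S × PowerSeries S => tPartial D cr.1 cr.2 K := by
  have hit : ∀ k, Continuous fun r : PowerSeries S => (⇑D)^[k] r := fun k => by
    induction k with
    | zero => exact continuous_id
    | succ k ih => simpa only [Function.iterate_succ'] using hDc.comp ih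
  simp only [tPartial_def]
  refine continuous_finsetSum _ fun k _ => ?_
  exact ((PowerSeries.WithPiTopology.continuous_C (R := S)).comp ((PowerSeries.WithPiTopology.continuous_coeff S k).comp continuous_fst)).mul
    ((hit k).comp continuous_snd)

include hD in
/-- ★★ **`(c, r) ↦ c(T)·r` is (jointly) CONTINUOUS** — each coefficient of `c(T)·r` is the UNIFORM limit of the corresponding coefficients of the
polynomial operators `Σ_{k<K} c_k D^k r` (error in `p^{K-k}S`). [cite: Washington1997, §13.2] [cite: deShalit1987, Ch. I §3.1] -/
theorem continuous_tAct [IsPrecomplete (Ideal.span {p}) S] (hp : ∀ U ∈ 𝓝 (0 : S), ∃ n : ℕ, ∀ s : S, p ^ n * s ∈ U)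
    (hDc : Continuous D) : Continuous fun cr : PowerSeries S × PowerSeries S => tAct D hD cr.1 cr.2 := by
  refine PowerSeries.WithPiTopology.continuous_iff_coeff.mpr fun k => ?_
  -- uniform structure from the additive group topology
  letI : UniformSpace S := IsTopologicalAddGroup.rightUniformSpace S
  haveI : IsUniformAddGroup S := isUniformAddGroup_of_addCommGroup
  have hunif : TendstoUniformly (fun K (cr : PowerSeries S × PowerSeries S) => PowerSeries.coeff k (tPartial D cr.1 cr.2 K))
      (fun cr => PowerSeries.coeff k (tAct D hD cr.1 cr.2)) atTop := by
    rw [tendstoUniformly_iff_tendsto, uniformity_eq_comap_nhds_zero S, tendsto_comap_iff]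
    rw [tendsto_def]
    intro U hU
    obtain ⟨n, hn⟩ := hp U hU
    rw [mem_prod_iff]
    refine ⟨Set.Ici (n + k), mem_atTop _, Set.univ, univ_mem, ?_⟩
    rintro ⟨K, cr⟩ ⟨hK, -⟩
    rw [Set.mem_Ici] at hK
    rw [Set.mem_preimage, Function.comp_apply]
    change PowerSeries.coeff k (tPartial D cr.1 cr.2 K) - PowerSeries.coeff k (tAct D hD cr.1 cr.2) ∈ U
    obtain ⟨s, hs⟩ := exists_coeff_eq_pow_mul_of_mem_adicFiltGen (k := k) (tAct_sub_tPartial_mem hD cr.1 cr.2 K)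
    rw [map_sub] at hs
    rw [← neg_sub, hs]
    obtain ⟨j, hj⟩ := Nat.exists_eq_add_of_le (show n ≤ K - k by omega)
    rw [hj, pow_add, mul_assoc, ← mul_neg]
    exact hn _
  exact hunif.continuous (Frequently.of_forall fun K => (PowerSeries.WithPiTopology.continuous_coeff S k).comp (continuous_tPartial hDc K))

include hD in
/-- `r ↦ c(T)·r` is continuous. [cite: Washington1997, §13.2] -/
theorem continuous_tAct_right [IsPrecomplete (Ideal.span {p}) S] (hp : ∀ U ∈ 𝓝 (0 : S), ∃ n : ℕ, ∀ s : S, p ^ n * s ∈ U)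
    (hDc : Continuous D) (c : PowerSeries S) : Continuous fun r : PowerSeries S => tAct D hD c r := by
  have h1 : Continuous fun cr : PowerSeries S × PowerSeries S => tAct D hD cr.1 cr.2 := continuous_tAct hD hp hDc
  have h2 : Continuous fun r : PowerSeries S => (c, r) := continuous_const.prodMk continuous_id
  exact Continuous.comp (g := fun cr : PowerSeries S × PowerSeries S => tAct D hD cr.1 cr.2) (f := fun r : PowerSeries S => (c, r)) h1 h2

include hD in
/-- `c ↦ c(T)·r` is continuous. [cite: Washington1997, §13.2] -/
theorem continuous_tAct_left [IsPrecomplete (Ideal.span {p}) S] (hp : ∀ U ∈ 𝓝 (0 : S), ∃ n : ℕ, ∀ s : S, p ^ n * s ∈ U)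
    (hDc : Continuous D) (r : PowerSeries S) : Continuous fun c : PowerSeries S => tAct D hD c r := by
  have h1 : Continuous fun cr : PowerSeries S × PowerSeries S => tAct D hD cr.1 cr.2 := continuous_tAct hD hp hDc
  have h2 : Continuous fun c : PowerSeries S => (c, r) := continuous_id.prodMk continuous_const
  exact Continuous.comp (g := fun cr : PowerSeries S × PowerSeries S => tAct D hD cr.1 cr.2) (f := fun c : PowerSeries S => (c, r)) h1 h2

end TActContinuous

/-! ### §3. `TActModule D hD` as a topological module -/

namespace TActModule

variable {S : Type*} [CommRing S] {p : S} {D : PowerSeries S →ₗ[S] PowerSeries S}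
  {hD : ∀ N (r : PowerSeries S), r ∈ adicFiltGen p N → D r ∈ adicFiltGen p (N + 1)}
variable [TopologicalSpace S]

/-- The topology of `TActModule D hD` is the coefficientwise topology of `S⟦Y⟧`. [cite: Washington1997, §13.2] -/
instance instTopologicalSpace : TopologicalSpace (TActModule D hD) := inferInstanceAs (TopologicalSpace (PowerSeries S))

/-- `toPS` is continuous (it is the identity). [cite: Washington1997, §13.2] -/
theorem continuous_toPS : Continuous (toPS : TActModule D hD → PowerSeries S) := continuous_id

variable (D hD) in
/-- `ofPS` is continuous (it is the identity). [cite: Washington1997, §13.2] -/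
theorem continuous_ofPS : Continuous (ofPS D hD : PowerSeries S → TActModule D hD) := continuous_id

variable (D hD) in
/-- `S⟦Y⟧ ≃ₜ TActModule D hD` (the identity as a homeomorphism). [cite: Washington1997, §13.2] -/
def ofPSHomeomorph : PowerSeries S ≃ₜ TActModule D hD where
  toEquiv := (ofPS D hD).toEquiv
  continuous_toFun := continuous_id
  continuous_invFun := continuous_id

/-- Unfolding the homeomorphism. [cite: Washington1997, §13.2] -/
@[simp] theorem ofPSHomeomorph_apply (r : PowerSeries S) : ofPSHomeomorph D hD r = ofPS D hD r := rfl

/-- A map into `TActModule` is continuous iff its composite with `toPS` is. [cite: Washington1997, §13.2] -/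
theorem continuous_iff_toPS {X : Type*} [TopologicalSpace X] {f : X → TActModule D hD} :
    Continuous f ↔ Continuous fun x => toPS (f x) := Iff.rfl

/-- Hausdorff. [cite: BourbakiGT1, Ch. I §8.2 Prop. 7] -/
instance instT2Space [T2Space S] : T2Space (TActModule D hD) := inferInstanceAs (T2Space (PowerSeries S))

/-- ★ COMPACT when `S` is (Tychonoff). [cite: Washington1997, §13.2 (compact Λ-modules)] -/
instance instCompactSpace [CompactSpace S] : CompactSpace (TActModule D hD) :=
  show CompactSpace (PowerSeries S) from PowerSeries.WithPiTopology.compactSpace S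

/-- A topological additive group. [cite: BourbakiGT1, Ch. III §6.3] -/
instance instIsTopologicalAddGroup [IsTopologicalRing S] : IsTopologicalAddGroup (TActModule D hD) :=
  inferInstanceAs (IsTopologicalAddGroup (PowerSeries S))

variable [IsTopologicalRing S] [IsAdicComplete (Ideal.span {p}) S]

/-- ★★ **The `S⟦T⟧`-action on `TActModule D hD` is continuous** (for continuous `D` and `p^n S → 0` uniformly).
[cite: Washington1997, §13.2] [cite: deShalit1987, Ch. I §3.1] -/
theorem continuousSMul (hp : ∀ U ∈ 𝓝 (0 : S), ∃ n : ℕ, ∀ s : S, p ^ n * s ∈ U) (hDc : Continuous D) :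
    ContinuousSMul (PowerSeries S) (TActModule D hD) :=
  ⟨continuous_tAct hD hp hDc⟩

/-- `r ↦ c • r` is continuous. [cite: Washington1997, §13.2] -/
theorem continuous_smul_right (hp : ∀ U ∈ 𝓝 (0 : S), ∃ n : ℕ, ∀ s : S, p ^ n * s ∈ U) (hDc : Continuous D) (c : PowerSeries S) :
    Continuous fun r : TActModule D hD => c • r :=
  continuous_tAct_right hD hp hDc c

/-- `c ↦ c • r` is continuous. [cite: Washington1997, §13.2] -/
theorem continuous_smul_left (hp : ∀ U ∈ 𝓝 (0 : S), ∃ n : ℕ, ∀ s : S, p ^ n * s ∈ U) (hDc : Continuous D) (r : TActModule D hD) :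
    Continuous fun c : PowerSeries S => c • r :=
  continuous_tAct_left hD hp hDc (toPS r)

/-- `r ↦ (C s) • r` is continuous for every constant (no hypothesis on `D`: it is multiplication by `C s`). [cite: Washington1997, §13.2] -/
theorem continuous_C_smul_right (s : S) : Continuous fun r : TActModule D hD => (PowerSeries.C s : PowerSeries S) • r := by
  have e : (fun r : TActModule D hD => (PowerSeries.C s : PowerSeries S) • r) = fun r => ofPS D hD (PowerSeries.C s * toPS r) :=
    funext fun r => C_smul s r
  rw [e]
  exact PowerSeries.WithPiTopology.continuous_mul_left _

/-- `s ↦ (C s) • r` is continuous. [cite: Washington1997, §13.2] -/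
theorem continuous_C_smul_left (r : TActModule D hD) : Continuous fun s : S => (PowerSeries.C s : PowerSeries S) • r := by
  have e : (fun s : S => (PowerSeries.C s : PowerSeries S) • r) = fun s => ofPS D hD (PowerSeries.C s * toPS r) :=
    funext fun s => C_smul s r
  rw [e]
  exact ((PowerSeries.WithPiTopology.continuous_C (R := S)).mul continuous_const)

omit [IsTopologicalRing S] in
/-- `r ↦ T • r = D r` is continuous for continuous `D`. [cite: Washington1997, §13.2] -/
theorem continuous_X_smul_right (hDc : Continuous D) : Continuous fun r : TActModule D hD => (PowerSeries.X : PowerSeries S) • r := by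
  have e : (fun r : TActModule D hD => (PowerSeries.X : PowerSeries S) • r) = fun r => ofPS D hD (D (toPS r)) := funext fun r => X_smul r
  rw [e]
  exact hDc

end TActModule

end LubinTate

/-! ### §4. Closed subgroups stable under `T` and the constants are `S⟦T⟧`-submodules -/

section ClosedSubmodule

variable {S : Type*} [CommRing S] [TopologicalSpace S]
variable {M : Type*} [AddCommGroup M] [Module (PowerSeries S) M] [TopologicalSpace M]

omit [TopologicalSpace S] [TopologicalSpace M] in
/-- A subgroup stable under `T•` and `C s •` is stable under every POLYNOMIAL `q(T)•`. [cite: Washington1997, §13.2] -/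
theorem polynomial_smul_mem {Z : AddSubgroup M} (hC : ∀ (s : S), ∀ z ∈ Z, (PowerSeries.C s : PowerSeries S) • z ∈ Z)
    (hX : ∀ z ∈ Z, (PowerSeries.X : PowerSeries S) • z ∈ Z) (q : Polynomial S) {z : M} (hz : z ∈ Z) :
    ((q : PowerSeries S)) • z ∈ Z := by
  induction q using Polynomial.induction_on' with
  | add q₁ q₂ h₁ h₂ => rw [Polynomial.coe_add, add_smul]; exact Z.add_mem h₁ h₂
  | monomial n a =>
    rw [← Polynomial.C_mul_X_pow_eq_monomial, Polynomial.coe_mul, Polynomial.coe_pow, Polynomial.coe_C, Polynomial.coe_X, mul_smul]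
    refine hC a _ ?_
    induction n with
    | zero => rwa [pow_zero, one_smul]
    | succ n ih => rw [pow_succ', mul_smul]; exact hX _ ih

/-- ★★★ **A CLOSED additive subgroup of a topological `S⟦T⟧`-module, stable under `T•` and the constants `C s •`, is stable under EVERY
`c ∈ S⟦T⟧`** (when `c ↦ c • z` is continuous: polynomials are dense in `S⟦T⟧`). This is how "closed `Γ`-submodules are `Λ`-submodules".
[cite: Washington1997, §13.2] [cite: deShalit1987, Ch. I §3.1] -/
theorem smul_mem_of_isClosed {Z : AddSubgroup M} (hZ : IsClosed (Z : Set M)) (hcont : ∀ z : M, Continuous fun c : PowerSeries S => c • z)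
    (hC : ∀ (s : S), ∀ z ∈ Z, (PowerSeries.C s : PowerSeries S) • z ∈ Z) (hX : ∀ z ∈ Z, (PowerSeries.X : PowerSeries S) • z ∈ Z)
    (c : PowerSeries S) {z : M} (hz : z ∈ Z) : c • z ∈ Z := by
  have hdense := PowerSeries.WithPiTopology.denseRange_toPowerSeries S
  have hsub : (fun c : PowerSeries S => c • z) '' Set.range (Polynomial.toPowerSeries (R := S)) ⊆ (Z : Set M) := by
    rintro _ ⟨_, ⟨q, rfl⟩, rfl⟩
    exact polynomial_smul_mem hC hX q hz
  have h' : c • z ∈ closure ((fun c : PowerSeries S => c • z) '' Set.range (Polynomial.toPowerSeries (R := S))) :=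
    (hcont z).range_subset_closure_image_dense hdense ⟨c, rfl⟩
  have h3 := closure_mono hsub h'
  rwa [hZ.closure_eq] at h3

/-- The `S⟦T⟧`-submodule structure on a closed subgroup stable under `T•` and the constants. [cite: Washington1997, §13.2] -/
def submoduleOfIsClosed (Z : AddSubgroup M) (hZ : IsClosed (Z : Set M)) (hcont : ∀ z : M, Continuous fun c : PowerSeries S => c • z)
    (hC : ∀ (s : S), ∀ z ∈ Z, (PowerSeries.C s : PowerSeries S) • z ∈ Z) (hX : ∀ z ∈ Z, (PowerSeries.X : PowerSeries S) • z ∈ Z) :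
    Submodule (PowerSeries S) M where
  carrier := Z
  add_mem' := Z.add_mem
  zero_mem' := Z.zero_mem
  smul_mem' c _ hz := smul_mem_of_isClosed hZ hcont hC hX c hz

/-- The carrier of `submoduleOfIsClosed` is `Z`. [cite: Washington1997, §13.2] -/
@[simp] theorem mem_submoduleOfIsClosed {Z : AddSubgroup M} {hZ : IsClosed (Z : Set M)} {hcont : ∀ z : M, Continuous fun c : PowerSeries S => c • z}
    {hC : ∀ (s : S), ∀ z ∈ Z, (PowerSeries.C s : PowerSeries S) • z ∈ Z} {hX : ∀ z ∈ Z, (PowerSeries.X : PowerSeries S) • z ∈ Z} {m : M} :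
    m ∈ submoduleOfIsClosed Z hZ hcont hC hX ↔ m ∈ Z := Iff.rfl

omit [TopologicalSpace S] [TopologicalSpace M] in
/-- Stability under `(1 + T)•` (a group element `γ`) is the same as stability under `T•`. [cite: deShalit1987, Ch. I §3.1] -/
theorem X_smul_mem_iff_one_add_X_smul_mem {Z : AddSubgroup M} {z : M} (hz : z ∈ Z) :
    (PowerSeries.X : PowerSeries S) • z ∈ Z ↔ ((1 + PowerSeries.X : PowerSeries S)) • z ∈ Z := by
  rw [add_smul, one_smul]
  exact ⟨fun h => Z.add_mem hz h, fun h => by simpa using Z.sub_mem h hz⟩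

/-- ★ **Constants from a DENSE subset suffice**: if `Z` is closed, `s ↦ (C s) • z` is continuous and `(C s) • z ∈ Z` for `s` in a dense
subset `T ⊆ S`, then `(C s) • z ∈ Z` for all `s` (principle of extension of identities). [cite: BourbakiGT1, Ch. I §2.1 Th. 1] [cite: Washington1997, §13.2] -/
theorem C_smul_mem_of_dense {Z : AddSubgroup M} (hZ : IsClosed (Z : Set M)) {T : Set S} (hT : Dense T)
    (hcont : ∀ z : M, Continuous fun s : S => (PowerSeries.C s : PowerSeries S) • z)
    (hC : ∀ s ∈ T, ∀ z ∈ Z, (PowerSeries.C s : PowerSeries S) • z ∈ Z) (s : S) {z : M} (hz : z ∈ Z) :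
    (PowerSeries.C s : PowerSeries S) • z ∈ Z := by
  have h1 : (fun s : S => (PowerSeries.C s : PowerSeries S) • z) '' T ⊆ (Z : Set M) := by
    rintro _ ⟨t, ht, rfl⟩; exact hC t ht z hz
  have h2 : (PowerSeries.C s : PowerSeries S) • z ∈ closure ((fun s : S => (PowerSeries.C s : PowerSeries S) • z) '' T) :=
    (hcont z).range_subset_closure_image_dense hT ⟨s, rfl⟩
  have h3 := closure_mono h1 h2
  rwa [hZ.closure_eq] at h3

/-- **`ℕ` dense ⇒ the constants come for free**: in a closed subgroup, `(C n) • z = n • z ∈ Z`; so if `ℕ` is dense in `S` (e.g. `S = ℤ_p`)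
every constant `C s` preserves `Z`. [cite: Washington1997, §13.2] -/
theorem C_smul_mem_of_denseRange_natCast {Z : AddSubgroup M} (hZ : IsClosed (Z : Set M)) (hN : DenseRange (Nat.cast : ℕ → S))
    (hcont : ∀ z : M, Continuous fun s : S => (PowerSeries.C s : PowerSeries S) • z) (s : S) {z : M} (hz : z ∈ Z) :
    (PowerSeries.C s : PowerSeries S) • z ∈ Z := by
  refine C_smul_mem_of_dense hZ hN hcont ?_ s hz
  rintro _ ⟨n, rfl⟩ w hw
  rw [map_natCast, Nat.cast_smul_eq_nsmul]
  exact Z.nsmul_mem hw n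

end ClosedSubmodule

/-! ### §4b. Two variables: `S = S₀⟦X⟧`, constants `C (C a)` and `C X` suffice -/

section TwoVariables

variable {S₀ : Type*} [CommRing S₀] [TopologicalSpace S₀] [IsTopologicalRing S₀]
variable {M : Type*} [AddCommGroup M] [Module (PowerSeries (PowerSeries S₀)) M] [TopologicalSpace M]

omit [TopologicalSpace S₀] [IsTopologicalRing S₀] [TopologicalSpace M] in
/-- Over `S = S₀⟦X⟧`: a subgroup stable under `C (C a) •` (`a ∈ S₀`) and `C X •` is stable under `C q •` for every polynomial `q ∈ S₀[X]`.
[cite: deShalit1987, Ch. I §3.1] -/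
theorem C_polynomial_smul_mem {Z : AddSubgroup M}
    (hCC : ∀ (a : S₀), ∀ z ∈ Z, (PowerSeries.C (PowerSeries.C a) : PowerSeries (PowerSeries S₀)) • z ∈ Z)
    (hCX : ∀ z ∈ Z, (PowerSeries.C PowerSeries.X : PowerSeries (PowerSeries S₀)) • z ∈ Z) (q : Polynomial S₀) {z : M} (hz : z ∈ Z) :
    (PowerSeries.C (q : PowerSeries S₀) : PowerSeries (PowerSeries S₀)) • z ∈ Z := by
  induction q using Polynomial.induction_on' with
  | add q₁ q₂ h₁ h₂ => rw [Polynomial.coe_add, map_add, add_smul]; exact Z.add_mem h₁ h₂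
  | monomial n a =>
    rw [← Polynomial.C_mul_X_pow_eq_monomial, Polynomial.coe_mul, Polynomial.coe_pow, Polynomial.coe_C, Polynomial.coe_X, map_mul, map_pow,
      mul_smul]
    refine hCC a _ ?_
    induction n with
    | zero => rwa [pow_zero, one_smul]
    | succ n ih => rw [pow_succ', mul_smul]; exact hCX _ ih

omit [IsTopologicalRing S₀] in
/-- ★ **Two variables**: a CLOSED subgroup stable under `C (C a) •` (`a ∈ S₀`) and `C X •`, with `s ↦ (C s) • z` continuous on `S₀⟦X⟧`, is
stable under `C s •` for every `s ∈ S₀⟦X⟧` (polynomials are dense in `S₀⟦X⟧`). With `smul_mem_of_isClosed` this makes a closed subgroup stable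
under `T•`, `X•` (i.e. `C X •`) and the constants of `S₀` an `S₀⟦X⟧⟦T⟧`-submodule. [cite: deShalit1987, Ch. I §3.1] [cite: Washington1997, §13.2] -/
theorem C_smul_mem_of_isClosed_twoVariable {Z : AddSubgroup M} (hZ : IsClosed (Z : Set M))
    (hcont : ∀ z : M, Continuous fun s : PowerSeries S₀ => (PowerSeries.C s : PowerSeries (PowerSeries S₀)) • z)
    (hCC : ∀ (a : S₀), ∀ z ∈ Z, (PowerSeries.C (PowerSeries.C a) : PowerSeries (PowerSeries S₀)) • z ∈ Z)
    (hCX : ∀ z ∈ Z, (PowerSeries.C PowerSeries.X : PowerSeries (PowerSeries S₀)) • z ∈ Z) (s : PowerSeries S₀) {z : M} (hz : z ∈ Z) :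
    (PowerSeries.C s : PowerSeries (PowerSeries S₀)) • z ∈ Z := by
  have hdense := PowerSeries.WithPiTopology.denseRange_toPowerSeries S₀
  have hsub : (fun s : PowerSeries S₀ => (PowerSeries.C s : PowerSeries (PowerSeries S₀)) • z) '' Set.range (Polynomial.toPowerSeries (R := S₀))
      ⊆ (Z : Set M) := by
    rintro _ ⟨_, ⟨q, rfl⟩, rfl⟩
    exact C_polynomial_smul_mem hCC hCX q hz
  have h' := (hcont z).range_subset_closure_image_dense hdense ⟨s, rfl⟩
  have h3 := closure_mono hsub h'
  rwa [hZ.closure_eq] at h3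

end TwoVariables

end Literature.NumberTheory.GaloisRepresentations
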